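/-
Copyright: the b2b-balaban T⁴-continuum CRUX team, row NE7b leaf lineage `t4-ne7b-formalise-leaf-02` (gen 135). Project licence.
-/
import Summits.QuantumFields.BalabanUV.T4Continuum.Spine.NE7b.AdmissibleFloorSeminormTwoFamilies
import Summits.QuantumFields.BalabanUV.T4Continuum.Spine.NE7b.SineTentQuadraticPartition

/-!
# THE TWO-FAMILY SEMINORM-IMS FLOOR AT k = 1 WITH THE SINE-TENT QUADRATIC PARTITION: `…AdmissibleFloorSeminormTwoFamilies.ims_floor_of_linear_terms_two`
# with `hpart` ∕ `hlip_i` ∕ `hμ_i` DISCHARGED on the torus for BOTH families by `…SineTentQuadraticPartition` — each family read with ITS OWN displacement letter: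
# `λ_i = D_i·π∕(2L)`, `μ_i = (a_i+1)·2^d` in general, and `λ₁ = π∕(2L)`, `μ₁ = 2^d` for a family in the plaquette shape; `ε = ε₁ + ε₂`, `ε_i = μ_iℓ_i²λ_i²a_ib_i`
# (row NE7b, node U5c; residual (R2′) family (2), letter (ℓ1); one-`exact` junctions — `…SineTentFloor`'s pattern for the full form's two families)

Cell `pub-balaban`, sub-cell `t4`, spine estimate NE7b (`T4WeightBudget.RelWeightBound`; the cell's OWN estimate — NOT PRINTED in [Bałaban 1983–89],
NOT PROVED).  Crux-route work under `Spine/NE7b/`; NOTHING of Bałaban's estimates is asserted; no `def`; zero `sorry`; no `T4Continuum/Support` leaf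
(FREEZE (0)).  Imports BY NAME: leaf-05 g158's `…AdmissibleFloorSeminormTwoFamilies` (AFS2: `ims_floor_of_linear_terms_two`) and this lineage's
`…SineTentQuadraticPartition` (STQ: `sum_sq_prod_sin_tent_eq_one`, `abs_prod_sin_tent_sub_le_of_disp` ∕ `_of_unit`, `card_varying_on_term_sin_tent_le` ∕ `_of_unit`).

WHY.  At `k = 1` the (h2) slot's full form `F(B′) = n^{d−2}Σ_c|(Q₁B′)(c)|² + Σ_P|(∂B′)(P)|²` has TWO families of linear local terms on one bond field: the
plaquette curls (term diameter `1`: the `hunit` shape of `…PlaquetteTermDisplacement`) and the next-level block averages (every bond an `ℓ¹`-forward displacement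
of length `≤ (d+1)(n−1)` from the term's reference site: the `hdisp` shape of `…TorusAverageIncidence.exists_displacement_avgBonds`).  AFS2 takes per-family
partition letters `(λ_i, μ_i)`; `…SineTentFloor` (STF) discharged them for ONE family.  THIS FILE does the same bookkeeping for two families, ONE sine-tent
partition `h_S(c) := Π_ν sin(π∕2·tentZ L ((pt c)_ν − (S_ν·L + c₀)))` on the torus `A → ZMod N`, `N = M·L`, read on each family through its own shape letter.

WHAT IS PROVED ([folklore]; `0 < L`, `2 ≤ M`, `N = M·L`, offset `c₀`; cutoffs written out):
* **`ims_floor_of_sine_tent_partition_two`** — two families of linear local terms `T^i_j x = Σ_{c∈inc_i j}R^i_{j,c}(x c)` (`‖R^i_{j,c}v‖ ≤ ℓ_i‖v‖`,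
  `#inc_i j ≤ a_i`, `#{j : c ∈ inc_i j} ≤ b_i`), bonds read at torus sites `pt`, per-term `ℓ¹`-witnesses of length `≤ D_i` from `ref_i j`, local floors `c_loc`
  for the cutoffs `h_S` on `good` (both families on the right), `Σ_j‖T¹_j x‖² + Σ_j‖T²_j x‖² ≤ F x` on `good`
  ⊢ `((c_loc − (1+t⁻¹)·((a₁+1)2^d·ℓ₁²·(D₁π∕(2L))²·a₁b₁ + (a₂+1)2^d·ℓ₂²·(D₂π∕(2L))²·a₂b₂))∕(1+t))·Σ_c‖x c‖² ≤ F x`.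
* **`ims_floor_of_sine_tent_partition_two_unit_disp`** — the lattice instance's shape: family 1 in the plaquette shape (`hunit`: `λ₁ = π∕(2L)`, `μ₁ = 2^d`),
  family 2 with displacement witnesses (`hdisp`: `λ₂ = D₂π∕(2L)`, `μ₂ = (a₂+1)2^d`)
  ⊢ `((c_loc − (1+t⁻¹)·(2^d·ℓ₁²·(π∕(2L))²·a₁b₁ + (a₂+1)2^d·ℓ₂²·(D₂π∕(2L))²·a₂b₂))∕(1+t))·Σ_c‖x c‖² ≤ F x`.
* §3 toy (`example`): `A = Fin 1`, one one-term family twice on one bond at one site, `R = id` on `ℝ` — elaboration of the `_unit_disp` junction with `D₂ = 0`.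

NOT HERE (honest): the term data of either family (`…CurlTermsLinear` ∕ `…AverageTermsLinear`), the local floors `c_loc` (the per-cube gauge letters and the
currency question Q-leaf05-g157-1), `F` := the full form, `good`; anything of Bałaban's estimates.  BY-NAME EFFECT ON THE WALL: NONE.  NE7b NOT PRINTED ∕ NOT
PROVED; spine PROVED 0∕9; rung (B)+1 on ONE finite T⁴ — NOT infinite volume, NOT the mass gap, NOT Clay.
HONEST DEPENDENCY: continuum YM on T⁴ ⇐ BetaPertH ∧ nine spine estimates (0/9 proved); BetaPertH ⇐ (D1) ∧ (D4) ∧ CAP+tail; G-an2-4 gates asym, D1 and NE2/3/4.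
-/

set_option autoImplicit false

noncomputable section

open Finset
open Literature.MathematicalPhysics.QuantumFieldTheory.Balaban1983to89.B14.TentUnityTorus (tentZ)
open Summit.QuantumFields.BalabanUV.T4Continuum.NE7b.AdmissibleFloorSeminormTwoFamilies (ims_floor_of_linear_terms_two)
open Summit.QuantumFields.BalabanUV.T4Continuum.NE7b.SineTentQuadraticPartition (sum_sq_prod_sin_tent_eq_one abs_prod_sin_tent_sub_le_of_disp
  abs_prod_sin_tent_sub_le_of_unit card_varying_on_term_sin_tent_le card_varying_on_term_sin_tent_le_of_unit)

namespace Summit.QuantumFields.BalabanUV.T4Continuum.NE7b.SineTentFloorTwoFamilies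

variable {A : Type*} [Fintype A] [DecidableEq A]
variable {J₁ J₂ C : Type*} [Fintype J₁] [Fintype J₂] [Fintype C]
variable {W V₁ V₂ : Type*} [NormedAddCommGroup W] [NormedSpace ℝ W]
  [NormedAddCommGroup V₁] [NormedSpace ℝ V₁] [NormedAddCommGroup V₂] [NormedSpace ℝ V₂]

/-! ## §1 Both families with displacement witnesses -/

/-- **THE TWO-FAMILY (h2) FLOOR WITH THE SINE-TENT QUADRATIC PARTITION** — AFS2 `ims_floor_of_linear_terms_two` with
`h_S(c) := Π_ν sin(π∕2·tentZ L ((pt c)_ν − (S_ν·L + c₀)))`, `hpart` exact, `λ_i = D_i·π∕(2L)`, `μ_i = (a_i+1)·2^{#A}` supplied per family by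
`…SineTentQuadraticPartition` from the family's displacement letter `hdisp_i`. [folklore] -/
theorem ims_floor_of_sine_tent_partition_two [DecidableEq C] (L M N : ℕ) [NeZero M] [NeZero N] (hL : 0 < L) (hM : 2 ≤ M) (hN : N = M * L) (c₀ : ℕ)
    (inc₁ : J₁ → Finset C) (R₁ : J₁ → C → W →ₗ[ℝ] V₁) {ℓ₁ : ℝ} (hR₁ : ∀ j c v, ‖R₁ j c v‖ ≤ ℓ₁ * ‖v‖)
    (inc₂ : J₂ → Finset C) (R₂ : J₂ → C → W →ₗ[ℝ] V₂) {ℓ₂ : ℝ} (hR₂ : ∀ j c v, ‖R₂ j c v‖ ≤ ℓ₂ * ‖v‖)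
    (pt : C → A → ZMod N) (ref₁ : J₁ → C) (ref₂ : J₂ → C) (D₁ D₂ : ℕ)
    (hdisp₁ : ∀ j, ∀ b ∈ inc₁ j, ∃ wp wm : A → ℕ,
      pt b = pt (ref₁ j) + (fun ν => ((wp ν : ℕ) : ZMod N)) - (fun ν => ((wm ν : ℕ) : ZMod N)) ∧ ∑ ν, wp ν + ∑ ν, wm ν ≤ D₁)
    (hdisp₂ : ∀ j, ∀ b ∈ inc₂ j, ∃ wp wm : A → ℕ,
      pt b = pt (ref₂ j) + (fun ν => ((wp ν : ℕ) : ZMod N)) - (fun ν => ((wm ν : ℕ) : ZMod N)) ∧ ∑ ν, wp ν + ∑ ν, wm ν ≤ D₂)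
    {a₁ b₁ a₂ b₂ : ℕ} (ha₁ : ∀ j, (inc₁ j).card ≤ a₁) (hb₁ : ∀ c, (Finset.univ.filter fun j => c ∈ inc₁ j).card ≤ b₁)
    (ha₂ : ∀ j, (inc₂ j).card ≤ a₂) (hb₂ : ∀ c, (Finset.univ.filter fun j => c ∈ inc₂ j).card ≤ b₂)
    (good : (C → W) → Prop) {cloc : ℝ}
    (hloc : ∀ (S : A → ZMod M) (x : C → W), good x →
      cloc * ∑ c, ‖(∏ ν, Real.sin (Real.pi / 2 * tentZ (L : ℝ) (pt c ν - (((S ν).val * L + c₀ : ℕ) : ZMod N)))) • x c‖ ^ 2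
        ≤ ∑ j, ‖∑ c ∈ inc₁ j, R₁ j c ((∏ ν, Real.sin (Real.pi / 2 * tentZ (L : ℝ) (pt c ν - (((S ν).val * L + c₀ : ℕ) : ZMod N)))) • x c)‖ ^ 2
          + ∑ j, ‖∑ c ∈ inc₂ j, R₂ j c ((∏ ν, Real.sin (Real.pi / 2 * tentZ (L : ℝ) (pt c ν - (((S ν).val * L + c₀ : ℕ) : ZMod N)))) • x c)‖ ^ 2)
    (F : (C → W) → ℝ)
    (hF : ∀ x, good x → ∑ j, ‖∑ c ∈ inc₁ j, R₁ j c (x c)‖ ^ 2 + ∑ j, ‖∑ c ∈ inc₂ j, R₂ j c (x c)‖ ^ 2 ≤ F x)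
    {t : ℝ} (ht : 0 < t) (x : C → W) (hx : good x) :
    (cloc - (1 + t⁻¹) * ((((a₁ + 1) * 2 ^ Fintype.card A : ℕ) : ℝ) * ℓ₁ ^ 2 * (D₁ * (Real.pi / (2 * L))) ^ 2 * a₁ * b₁
        + (((a₂ + 1) * 2 ^ Fintype.card A : ℕ) : ℝ) * ℓ₂ ^ 2 * (D₂ * (Real.pi / (2 * L))) ^ 2 * a₂ * b₂)) / (1 + t)
      * ∑ c, ‖x c‖ ^ 2 ≤ F x :=
  ims_floor_of_linear_terms_two (ι := A → ZMod M) inc₁ R₁ hR₁ inc₂ R₂ hR₂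
    (fun (S : A → ZMod M) (c : C) => ∏ ν, Real.sin (Real.pi / 2 * tentZ (L : ℝ) (pt c ν - (((S ν).val * L + c₀ : ℕ) : ZMod N))))
    (fun c => sum_sq_prod_sin_tent_eq_one L M N hL hM hN c₀ (pt c)) ref₁ ref₂
    (lam₁ := D₁ * (Real.pi / (2 * L))) (lam₂ := D₂ * (Real.pi / (2 * L))) (by positivity) (by positivity)
    (fun S j c hc => abs_prod_sin_tent_sub_le_of_disp L M N hL hM hN c₀ pt inc₁ ref₁ D₁ hdisp₁ S j c hc)
    (fun S j c hc => abs_prod_sin_tent_sub_le_of_disp L M N hL hM hN c₀ pt inc₂ ref₂ D₂ hdisp₂ S j c hc)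
    (μ₁ := (a₁ + 1) * 2 ^ Fintype.card A) (μ₂ := (a₂ + 1) * 2 ^ Fintype.card A)
    (card_varying_on_term_sin_tent_le L M N hL hN c₀ pt inc₁ ref₁ ha₁) ha₁ hb₁
    (card_varying_on_term_sin_tent_le L M N hL hN c₀ pt inc₂ ref₂ ha₂) ha₂ hb₂ good hloc F hF ht x hx

/-! ## §2 The lattice instance's shape: plaquette-shaped first family, displacement witnesses for the second -/

/-- **… FIRST FAMILY IN THE PLAQUETTE SHAPE, SECOND WITH DISPLACEMENT WITNESSES** (`hunit₁`: `λ₁ = π∕(2L)`, `μ₁ = 2^{#A}`; `hdisp₂`: `λ₂ = D₂π∕(2L)`,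
`μ₂ = (a₂+1)2^{#A}`) ⊢ `((c_loc − (1+t⁻¹)·(2^d·ℓ₁²·(π∕(2L))²·a₁b₁ + (a₂+1)2^d·ℓ₂²·(D₂π∕(2L))²·a₂b₂))∕(1+t))·Σ_c‖x c‖² ≤ F x` — the shape the full form's
curl family (`…PlaquetteTermDisplacement.exists_unit_plaquetteBonds`) and average family (`…TorusAverageIncidence.exists_displacement_avgBonds`) have. [folklore] -/
theorem ims_floor_of_sine_tent_partition_two_unit_disp [DecidableEq C] (L M N : ℕ) [NeZero M] [NeZero N] (hL : 0 < L) (hM : 2 ≤ M) (hN : N = M * L)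
    (c₀ : ℕ)
    (inc₁ : J₁ → Finset C) (R₁ : J₁ → C → W →ₗ[ℝ] V₁) {ℓ₁ : ℝ} (hR₁ : ∀ j c v, ‖R₁ j c v‖ ≤ ℓ₁ * ‖v‖)
    (inc₂ : J₂ → Finset C) (R₂ : J₂ → C → W →ₗ[ℝ] V₂) {ℓ₂ : ℝ} (hR₂ : ∀ j c v, ‖R₂ j c v‖ ≤ ℓ₂ * ‖v‖)
    (pt : C → A → ZMod N) (ref₁ : J₁ → C) (ref₂ : J₂ → C)
    (hunit₁ : ∀ j, ∀ b ∈ inc₁ j, pt b = pt (ref₁ j) ∨ ∃ ν, pt b = Function.update (pt (ref₁ j)) ν (pt (ref₁ j) ν + 1))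
    (D₂ : ℕ)
    (hdisp₂ : ∀ j, ∀ b ∈ inc₂ j, ∃ wp wm : A → ℕ,
      pt b = pt (ref₂ j) + (fun ν => ((wp ν : ℕ) : ZMod N)) - (fun ν => ((wm ν : ℕ) : ZMod N)) ∧ ∑ ν, wp ν + ∑ ν, wm ν ≤ D₂)
    {a₁ b₁ a₂ b₂ : ℕ} (ha₁ : ∀ j, (inc₁ j).card ≤ a₁) (hb₁ : ∀ c, (Finset.univ.filter fun j => c ∈ inc₁ j).card ≤ b₁)
    (ha₂ : ∀ j, (inc₂ j).card ≤ a₂) (hb₂ : ∀ c, (Finset.univ.filter fun j => c ∈ inc₂ j).card ≤ b₂)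
    (good : (C → W) → Prop) {cloc : ℝ}
    (hloc : ∀ (S : A → ZMod M) (x : C → W), good x →
      cloc * ∑ c, ‖(∏ ν, Real.sin (Real.pi / 2 * tentZ (L : ℝ) (pt c ν - (((S ν).val * L + c₀ : ℕ) : ZMod N)))) • x c‖ ^ 2
        ≤ ∑ j, ‖∑ c ∈ inc₁ j, R₁ j c ((∏ ν, Real.sin (Real.pi / 2 * tentZ (L : ℝ) (pt c ν - (((S ν).val * L + c₀ : ℕ) : ZMod N)))) • x c)‖ ^ 2
          + ∑ j, ‖∑ c ∈ inc₂ j, R₂ j c ((∏ ν, Real.sin (Real.pi / 2 * tentZ (L : ℝ) (pt c ν - (((S ν).val * L + c₀ : ℕ) : ZMod N)))) • x c)‖ ^ 2)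
    (F : (C → W) → ℝ)
    (hF : ∀ x, good x → ∑ j, ‖∑ c ∈ inc₁ j, R₁ j c (x c)‖ ^ 2 + ∑ j, ‖∑ c ∈ inc₂ j, R₂ j c (x c)‖ ^ 2 ≤ F x)
    {t : ℝ} (ht : 0 < t) (x : C → W) (hx : good x) :
    (cloc - (1 + t⁻¹) * ((((2 ^ Fintype.card A : ℕ)) : ℝ) * ℓ₁ ^ 2 * (Real.pi / (2 * L)) ^ 2 * a₁ * b₁
        + (((a₂ + 1) * 2 ^ Fintype.card A : ℕ) : ℝ) * ℓ₂ ^ 2 * (D₂ * (Real.pi / (2 * L))) ^ 2 * a₂ * b₂)) / (1 + t)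
      * ∑ c, ‖x c‖ ^ 2 ≤ F x :=
  ims_floor_of_linear_terms_two (ι := A → ZMod M) inc₁ R₁ hR₁ inc₂ R₂ hR₂
    (fun (S : A → ZMod M) (c : C) => ∏ ν, Real.sin (Real.pi / 2 * tentZ (L : ℝ) (pt c ν - (((S ν).val * L + c₀ : ℕ) : ZMod N))))
    (fun c => sum_sq_prod_sin_tent_eq_one L M N hL hM hN c₀ (pt c)) ref₁ ref₂
    (lam₁ := Real.pi / (2 * L)) (lam₂ := D₂ * (Real.pi / (2 * L))) (by positivity) (by positivity)
    (fun S j c hc => abs_prod_sin_tent_sub_le_of_unit L M N hL hM hN c₀ pt inc₁ ref₁ hunit₁ S j c hc)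
    (fun S j c hc => abs_prod_sin_tent_sub_le_of_disp L M N hL hM hN c₀ pt inc₂ ref₂ D₂ hdisp₂ S j c hc)
    (μ₁ := 2 ^ Fintype.card A) (μ₂ := (a₂ + 1) * 2 ^ Fintype.card A)
    (card_varying_on_term_sin_tent_le_of_unit L M N hL hM hN c₀ pt inc₁ ref₁ hunit₁) ha₁ hb₁
    (card_varying_on_term_sin_tent_le L M N hL hN c₀ pt inc₂ ref₂ ha₂) ha₂ hb₂ good hloc F hF ht x hx

/-! ## §3 Toy: one bond at one site of the `L·M`-cycle, two one-term families, `R = id` on `ℝ` (elaboration only) -/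

/-- Toy (`A = Fin 1`, `J₁ = J₂ = C = Unit`, `W = V₁ = V₂ = ℝ`, `inc_i _ = {()}`, `R^i = id` so `ℓ_i = 1`, `pt _ = 0`, `ref_i _ = ()` — `hunit₁` by `Or.inl rfl`,
`hdisp₂` with `wp = wm = 0`, `D₂ = 0`; `good = True`, `c_loc = 2`, `F x = 2·(the two terms)`): the `_unit_disp` junction elaborates on inhabited letters. -/
example (L M N : ℕ) [NeZero M] [NeZero N] (hL : 0 < L) (hM : 2 ≤ M) (hN : N = M * L) (x : Unit → ℝ) : True := by
  have := ims_floor_of_sine_tent_partition_two_unit_disp (A := Fin 1) (J₁ := Unit) (J₂ := Unit) (C := Unit) (W := ℝ) (V₁ := ℝ) (V₂ := ℝ)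
    L M N hL hM hN 0
    (fun _ => {()}) (fun _ _ => LinearMap.id) (ℓ₁ := 1) (fun _ _ v => by simp)
    (fun _ => {()}) (fun _ _ => LinearMap.id) (ℓ₂ := 1) (fun _ _ v => by simp)
    (fun _ _ => (0 : ZMod N)) (fun _ => ()) (fun _ => ())
    (fun _ _ _ => Or.inl rfl) 0 (fun _ _ _ => ⟨fun _ => 0, fun _ => 0, by simp, by simp⟩)
    (a₁ := 1) (b₁ := 1) (a₂ := 1) (b₂ := 1) (fun _ => by simp) (fun _ => by simp) (fun _ => by simp) (fun _ => by simp)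
    (fun _ => True) (cloc := 2)
    (fun S y _ => by rw [two_mul]; simp)
    (fun y => 2 * (∑ j : Unit, ‖∑ c ∈ ({()} : Finset Unit), (LinearMap.id : ℝ →ₗ[ℝ] ℝ) (y c)‖ ^ 2))
    (fun y _ => by rw [two_mul]) one_pos x trivial
  trivial

end Summit.QuantumFields.BalabanUV.T4Continuum.NE7b.SineTentFloorTwoFamilies

end
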